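import Summits.Ventures.Crystal3D.Theorems.StickyWulffConstantCoaxialWallLawMidPlanarCertA
import Summits.Ventures.Crystal3D.Theorems.StickyWulffConstantCoaxialWallLawMidPlanarCertB
import Summits.Ventures.Crystal3D.Theorems.StickyWulffConstantCoaxialWallLawMidPlanarCertC
import Summits.Ventures.Crystal3D.Theorems.StickyWulffConstantCoaxialWallLawMidPlanarCertD
import Summits.Ventures.Crystal3D.Theorems.StickyWulffConstantCoaxialWallLawMidPlanarCertE
import Summits.Ventures.Crystal3D.Theorems.StickyWulffConstantCoaxialWallLawMidPlanarCertF
import Summits.Ventures.Crystal3D.Theorems.StickyWulffConstantCoaxialWallLawMidPlanarCertG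
import Summits.Ventures.Crystal3D.Theorems.StickyWulffConstantCoaxialWallLawMidPlanarCertH
import Summits.Ventures.Crystal3D.Theorems.StickyWulffConstantCoaxialWallLawMidPlanarCertI
import Summits.Ventures.Crystal3D.Theorems.StickyWulffConstantCoaxialWallLawMidPlanarCertJ
import Summits.Ventures.Crystal3D.Theorems.StickyWulffConstantCoaxialWallLawHalfPlanarCert
import HarnessLib

/-!
# The planar-heights certificate on `τ ∈ [0.345, 0.655]`, KERNEL GRADE (assembly of the `decide +kernel` sub-certificates)

HONEST FRAMING. Part of the venture `Summits/Ventures/Crystal3D` (cell `crystal3d-full`), helper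
`--supports` the crux `CoaxialWallLaw` (stmt-Ventures-19481, `route-Ventures-StickyWulffConstant`),
REGISTERED line `WallLedgerF`, open stub `stub_coaxialTwoSlabAdhesion`.  RUNG CREDIT ONLY; F-C1 not moved.

**`mp_cert_kernel : azSearchF mpTbl 62832 [5,12,12,12,12] 0 12 = true` on STANDARD AXIOMS** — expanded
(`azSearchFGo_succ_of_children`, `…HalfPlanarCert`) to depth 2 (depth 3 below the two largest subtrees `[0,3,4]`, `[0,4,3]`)
and closed by the sub-certificates `mp_kcert_…` (`…MidPlanarCertA … J`).  Consumed by `…CoaxialWallLawBiPlanarRowMid`.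
-/

namespace Summit.Ventures.Crystal3D.Theorems

/-- **The interval certificate, KERNEL GRADE** (assembled from the sub-certificates). -/
theorem mp_cert_kernel : azSearchF mpTbl 62832 [5, 12, 12, 12, 12] 0 12 = true := by
  unfold azSearchF
  rw [show (12 - 1 : ℕ) = 10 + 1 from rfl]
  apply azSearchFGo_succ_of_children
  intro a1 h1
  have h1' : a1 < 5 := by simpa [mpTbl] using h1
  rw [show (10 : ℕ) = 9 + 1 from rfl]
  apply azSearchFGo_succ_of_children
  intro a2 h2
  have h2' : a2 < 5 := by simpa [mpTbl] using h2
  interval_cases a1 <;> interval_cases a2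
  · norm_num [azFwdAux, azGet, mpTbl]
    exact mp_kcert_00
  · norm_num [azFwdAux, azGet, mpTbl]
    exact mp_kcert_01
  · norm_num [azFwdAux, azGet, mpTbl]
    exact mp_kcert_02
  · norm_num [azFwdAux, azGet, mpTbl]
    exact mp_kcert_03
  · norm_num [azFwdAux, azGet, mpTbl]
    exact mp_kcert_04
  · norm_num [azFwdAux, azGet, mpTbl]
    exact mp_kcert_10
  · norm_num [azFwdAux, azGet, mpTbl]
    exact mp_kcert_11
  · norm_num [azFwdAux, azGet, mpTbl]
    exact mp_kcert_12
  · norm_num [azFwdAux, azGet, mpTbl]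
    exact mp_kcert_13
  · norm_num [azFwdAux, azGet, mpTbl]
    exact mp_kcert_14
  · norm_num [azFwdAux, azGet, mpTbl]
    exact mp_kcert_20
  · norm_num [azFwdAux, azGet, mpTbl]
    exact mp_kcert_21
  · norm_num [azFwdAux, azGet, mpTbl]
    exact mp_kcert_22
  · norm_num [azFwdAux, azGet, mpTbl]
    exact mp_kcert_23
  · norm_num [azFwdAux, azGet, mpTbl]
    exact mp_kcert_24
  · norm_num [azFwdAux, azGet, mpTbl]
    exact mp_kcert_30
  · norm_num [azFwdAux, azGet, mpTbl]
    exact mp_kcert_31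
  · norm_num [azFwdAux, azGet, mpTbl]
    exact mp_kcert_32
  · norm_num [azFwdAux, azGet, mpTbl]
    exact mp_kcert_33
  · norm_num [azFwdAux, azGet, mpTbl]
    rw [show (9 : ℕ) = 8 + 1 from rfl]
    apply azSearchFGo_succ_of_children
    intro a3 h3
    have h3' : a3 < 5 := by simpa using h3
    interval_cases a3
    · norm_num [azFwdAux, azGet, mpTbl]
      exact mp_kcert_340
    · norm_num [azFwdAux, azGet, mpTbl]
      exact mp_kcert_341
    · norm_num [azFwdAux, azGet, mpTbl]
      exact mp_kcert_342
    · norm_num [azFwdAux, azGet, mpTbl]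
      exact mp_kcert_343
    · norm_num [azFwdAux, azGet, mpTbl]
      exact mp_kcert_344
  · norm_num [azFwdAux, azGet, mpTbl]
    exact mp_kcert_40
  · norm_num [azFwdAux, azGet, mpTbl]
    exact mp_kcert_41
  · norm_num [azFwdAux, azGet, mpTbl]
    exact mp_kcert_42
  · norm_num [azFwdAux, azGet, mpTbl]
    rw [show (9 : ℕ) = 8 + 1 from rfl]
    apply azSearchFGo_succ_of_children
    intro a3 h3
    have h3' : a3 < 5 := by simpa using h3
    interval_cases a3
    · norm_num [azFwdAux, azGet, mpTbl]
      exact mp_kcert_430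
    · norm_num [azFwdAux, azGet, mpTbl]
      exact mp_kcert_431
    · norm_num [azFwdAux, azGet, mpTbl]
      exact mp_kcert_432
    · norm_num [azFwdAux, azGet, mpTbl]
      exact mp_kcert_433
    · norm_num [azFwdAux, azGet, mpTbl]
      exact mp_kcert_434
  · norm_num [azFwdAux, azGet, mpTbl]
    exact mp_kcert_44

end Summit.Ventures.Crystal3D.Theorems
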